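import Summits.Schanuel.Schanuel.Theorems.ZilberEacHyperplaneMixedBounds
import Summits.Schanuel.Schanuel.Theorems.ZilberEacInvariantDirectionExistence
import HarnessLib

/-!
# Real hyperplanes, MIXED fast/slow regime: LABELLED existence with convergent transversal data

Zilber's Exponential-Algebraic Closedness, case ladder (host summit Schanuel, cell `pub-schanuel`,
seat 2, gen 12).  THEOREM R⁺⁺ (`exists_expPoint_realHyperplane_mixed`, gen 8) solves the mixed
system in the transformed coordinates `z` within `1/2` of the PRINCIPAL lattice centres.  THEOREM M
(`ZilberEacRotatingPower`) needs, for every LABEL `p ∈ ℤ^{s+1}`, a solution family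

  `z(m) = ρ(m) + (log m) d̂ + (2πi m) q`,   `ρ(m) → 2πi p + log â`   (`âⱼ = (Âⱼ)_{d̂ⱼ}(2πi q)`),

with CONVERGENT transversal data.  This is the moving-polydisc contraction around the labelled
continuous-branch centres (as in `ZilberEacHyperplaneSlowExistence`) with the R⁺⁺ smallness
re-centred (`ZilberEacHyperplaneMixedBounds.mixed_perturbation_small`), followed by diagonal
extraction and the translation `x = fastBack r c e z` back to the original system.

* `exists_solutions_hyperplane_mixed` — the labelled THEOREM R⁺⁺ (every label).

HONEST FRAMING: an existence theorem for explicit families inside an OPEN cell (the unlabelled form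
is THEOREM R⁺⁺, gen 8); `EC(3,2)` OPEN; NOT Schanuel's conjecture; EAC ⇏ SC.
-/

noncomputable section

open Complex MvPolynomial Metric Set Filter Topology
open Literature.NumberTheory.Transcendental Literature.ModelTheory.Zilber

set_option linter.dupNamespace false

namespace Summit.Schanuel.Schanuel.Theorems

section MixedLabelled

variable {s : ℕ}

/-- **Labelled existence over real hyperplanes in the mixed regime.**  Hypotheses of THEOREM R⁺⁺
(`r₀ ≠ 0`, `F₀ ≠ 0`, leading forms of `Â = fastData r c A F` non-vanishing at `2πi q`, `d̂₀ ≥ 1`,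
(i) `ν < d̂₀`, (ii) `d̂₀(1 + deg Fⱼ) < e d̂ⱼ`): for every label `p` there are `z(m) = ρ(m) + (log m) d̂ +
(2πi m) q` with `ρ(m) → 2πi p + log â` such that `x = fastBack r c e z(m)` solves
`e^{xⱼ} = Aⱼ(x) + e^{ℓ(x)} Fⱼ(e^{ℓ(x)})` for all `j` (large `m`). (new)
[cite: MantovaMasser2023, §1 p.5 (the open case dim π(V) = 2 in ℂ³×ℂˣ³)] -/
theorem exists_solutions_hyperplane_mixed (r : Fin (s + 1) → ℝ) (hr : r 0 ≠ 0) (c : ℂ)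
    (q : Fin (s + 1) → ℤ) (A : Fin (s + 1) → MvPolynomial (Fin (s + 1)) ℂ)
    (F : Fin (s + 1) → Polynomial ℂ) (hF : F 0 ≠ 0)
    (hA : ∀ j, eval (fun i => 2 * Real.pi * I * (q i : ℂ))
      (homogeneousComponent (fastData r c A F j).totalDegree (fastData r c A F j)) ≠ 0)
    (hd0 : 0 < (fastData r c A F 0).totalDegree)
    (hν : (((fastData r c A F 0).totalDegree : ℝ) / ((F 0).natDegree + 1) -
        ∑ i : Fin s, r i.succ * (fastData r c A F i.succ).totalDegree) / r 0 <
      (fastData r c A F 0).totalDegree)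
    (hfast : ∀ i : Fin s, F i.succ ≠ 0 →
      ((fastData r c A F 0).totalDegree : ℝ) * ((F i.succ).natDegree + 1) <
        ((F 0).natDegree + 1) * (fastData r c A F i.succ).totalDegree)
    (p : Fin (s + 1) → ℤ) :
    ∃ (z ρ : ℕ → Fin (s + 1) → ℂ),
      (∀ᶠ m : ℕ in atTop, ∀ j, exp (fastBack r c ((F 0).natDegree + 1) (z m) j) =
        eval (fastBack r c ((F 0).natDegree + 1) (z m)) (A j) +
          exp (ell r c (fastBack r c ((F 0).natDegree + 1) (z m))) *
            (F j).eval (exp (ell r c (fastBack r c ((F 0).natDegree + 1) (z m))))) ∧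
      (∀ m, z m = ρ m + ((Real.log m : ℝ) : ℂ) • (fun j => (((fastData r c A F j).totalDegree : ℕ) : ℂ)) +
        (2 * Real.pi * I * (m : ℂ)) • fun j => (q j : ℂ)) ∧
      Tendsto ρ atTop (𝓝 fun j => 2 * Real.pi * I * (p j : ℂ) +
        log (eval (fun i => 2 * Real.pi * I * (q i : ℂ))
          (homogeneousComponent (fastData r c A F j).totalDegree (fastData r c A F j)))) := by
  classical
  -- ### names
  set e : ℕ := (F 0).natDegree + 1 with he
  set Ah : Fin (s + 1) → MvPolynomial (Fin (s + 1)) ℂ := fastData r c A F with hAh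
  set c₀ : ℂ := (F 0).leadingCoeff with hc₀def
  have hc0 : c₀ ≠ 0 := Polynomial.leadingCoeff_ne_zero.2 hF
  set Fe : Polynomial ℂ := (F 0).eraseLead with hFe
  -- data: leading values `a`, the ratios `Âⱼ(m v)/(m^{d̂ⱼ} aⱼ) → 1`
  obtain ⟨a, ha⟩ : ∃ a : Fin (s + 1) → ℂ, a = fun j => eval (fun i => 2 * Real.pi * I * (q i : ℂ))
    (homogeneousComponent (Ah j).totalDegree (Ah j)) := ⟨_, rfl⟩
  have ha0 : ∀ j, a j ≠ 0 := fun j => by rw [ha]; exact hA j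
  obtain ⟨d, hd⟩ : ∃ d : Fin (s + 1) → ℂ, d = fun j => (((Ah j).totalDegree : ℕ) : ℂ) := ⟨_, rfl⟩
  obtain ⟨ratio, hratio⟩ : ∃ ratio : Fin (s + 1) → ℕ → ℂ, ratio = fun j (m : ℕ) =>
    eval (fun i => (m : ℂ) * (2 * Real.pi * I * (q i : ℂ))) (Ah j) /
      ((m : ℂ) ^ (Ah j).totalDegree * a j) := ⟨_, rfl⟩
  have hratio1 : ∀ j, Tendsto (ratio j) atTop (𝓝 1) := by
    intro j
    rw [hratio, ha]
    exact tendsto_latticeValue_div (Ah j) _ (hA j)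
  have hlogratio : ∀ j, Tendsto (fun m => log (ratio j m)) atTop (𝓝 0) := by
    intro j
    have h := (hratio1 j).clog Complex.one_mem_slitPlane
    rwa [Complex.log_one] at h
  have hratio_ne : ∀ᶠ m : ℕ in atTop, ∀ j, ratio j m ≠ 0 :=
    eventually_all.2 fun j => (hratio1 j).eventually (isOpen_ne.mem_nhds one_ne_zero)
  -- the logarithm branch, `y(m) = 2πi m`, the transversal part `rc(m)` (with drift), the centres
  obtain ⟨lb, hlb⟩ : ∃ lb : ℕ → Fin (s + 1) → ℂ, lb = fun (m : ℕ) j =>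
    (((Ah j).totalDegree : ℕ) : ℂ) * log (m : ℂ) + log (a j) + log (ratio j m) := ⟨_, rfl⟩
  obtain ⟨y, hy⟩ : ∃ y : ℕ → ℂ, y = fun (m : ℕ) => 2 * Real.pi * I * (m : ℂ) := ⟨_, rfl⟩
  obtain ⟨rp, hrp⟩ : ∃ rp : ℕ → Fin (s + 1) → ℂ,
    rp = fun (m : ℕ) j => 2 * Real.pi * I * (p j : ℂ) + log (a j) + log (ratio j m) := ⟨_, rfl⟩
  obtain ⟨rc, hrc⟩ : ∃ rc : ℕ → Fin (s + 1) → ℂ,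
    rc = fun (m : ℕ) => rp m + (log (m : ℂ)) • d := ⟨_, rfl⟩
  obtain ⟨cen, hcen⟩ : ∃ cen : ℕ → Fin (s + 1) → ℂ,
    cen = fun m => rc m + y m • fun j => (q j : ℂ) := ⟨_, rfl⟩
  have hc' : ∀ m j, cen m j = (m : ℂ) * (2 * Real.pi * I * (q j : ℂ)) +
      (2 * Real.pi * I * (p j : ℂ) + lb m j) := by
    intro m j
    simp only [hcen, hrc, hrp, hy, hlb, hd, Pi.add_apply, Pi.smul_apply, smul_eq_mul]
    ring
  have hrp_lim : Tendsto rp atTop (𝓝 fun j => 2 * Real.pi * I * (p j : ℂ) + log (a j)) := by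
    rw [hrp]
    refine tendsto_pi_nhds.2 fun j => ?_
    have h := (hlogratio j).const_add (2 * Real.pi * I * (p j : ℂ) + log (a j))
    rwa [add_zero] at h
  -- (C1) `exp cen(m)ⱼ = Âⱼ(m v)` eventually
  have hcexp : ∀ᶠ m : ℕ in atTop, ∀ j,
      exp (cen m j) = eval (fun k => (m : ℂ) * (2 * Real.pi * I * (q k : ℂ))) (Ah j) := by
    filter_upwards [hratio_ne, eventually_ge_atTop 1] with m hm hm1 j
    have hmC : (m : ℂ) ≠ 0 := by exact_mod_cast (show m ≠ 0 by omega)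
    rw [hc', Complex.exp_add, exp_natCast_mul_twoPiI_mul_intCast, one_mul, Complex.exp_add,
      exp_two_pi_I_mul_intCast, one_mul, hlb]
    dsimp only
    rw [Complex.exp_add, Complex.exp_add, Complex.exp_log (ha0 j), Complex.exp_log (hm j),
      Complex.exp_nat_mul, Complex.exp_log hmC, hratio]
    dsimp only
    have hden : (m : ℂ) ^ (Ah j).totalDegree * a j ≠ 0 := mul_ne_zero (pow_ne_zero _ hmC) (ha0 j)
    rw [mul_div_assoc', mul_comm ((m : ℂ) ^ (Ah j).totalDegree * a j), mul_div_assoc,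
      div_self hden, mul_one]
  -- (C2) `‖cen(m) - m v‖ = O(log m)`
  have hlog1 : ∀ j, ∀ᶠ m : ℕ in atTop, ‖log (ratio j m)‖ ≤ 1 := by
    intro j
    have h := (hlogratio j)
    rw [tendsto_zero_iff_norm_tendsto_zero] at h
    filter_upwards [h.eventually (gt_mem_nhds zero_lt_one)] with m hm
    exact hm.le
  have hcsmall : ∀ δ : ℝ, 0 < δ → ∀ᶠ m : ℕ in atTop,
      ‖cen m - fun i => (m : ℂ) * (2 * Real.pi * I * (q i : ℂ))‖ + 1 ≤ δ * m := by
    intro δ hδ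
    set K : ℝ := ∑ j, (‖(2 * Real.pi * I * (p j : ℂ) : ℂ)‖ + ‖log (a j)‖) + 2 with hK
    set Dg : ℝ := ∑ j, ((Ah j).totalDegree : ℝ) with hDg
    filter_upwards [eventually_all.2 hlog1, eventually_mul_log_add_le Dg K hδ, eventually_ge_atTop 1]
      with m hm hmδ hm1
    have hlogm : 0 ≤ Real.log m := Real.log_nonneg (by exact_mod_cast hm1)
    have hnlog : ‖log (m : ℂ)‖ = Real.log m := by
      rw [← Complex.natCast_log, Complex.norm_real, Real.norm_eq_abs, abs_of_nonneg hlogm]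
    have hcomp : ∀ j, ‖(cen m - fun i => (m : ℂ) * (2 * Real.pi * I * (q i : ℂ))) j‖ ≤
        Dg * Real.log m + (K - 1) := by
      intro j
      have e' : (cen m - fun i => (m : ℂ) * (2 * Real.pi * I * (q i : ℂ))) j =
          2 * Real.pi * I * (p j : ℂ) + lb m j := by
        rw [Pi.sub_apply, hc']; ring
      rw [e', hlb]
      dsimp only
      have hdj : ((Ah j).totalDegree : ℝ) ≤ Dg :=
        Finset.single_le_sum (f := fun j => ((Ah j).totalDegree : ℝ)) (fun _ _ => by positivity)
          (Finset.mem_univ j)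
      have hKj : ‖(2 * Real.pi * I * (p j : ℂ) : ℂ)‖ + ‖log (a j)‖ ≤ K - 2 := by
        have := Finset.single_le_sum
          (f := fun j => ‖(2 * Real.pi * I * (p j : ℂ) : ℂ)‖ + ‖log (a j)‖)
          (fun _ _ => by positivity) (Finset.mem_univ j)
        rw [hK]; linarith
      have hn1 : ‖(((Ah j).totalDegree : ℕ) : ℂ) * log (m : ℂ)‖ = (Ah j).totalDegree * Real.log m := by
        rw [norm_mul, Complex.norm_natCast, hnlog]
      calc ‖2 * Real.pi * I * (p j : ℂ) +
            ((((Ah j).totalDegree : ℕ) : ℂ) * log (m : ℂ) + log (a j) + log (ratio j m))‖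
          ≤ ‖(2 * Real.pi * I * (p j : ℂ) : ℂ)‖ +
            ‖(((Ah j).totalDegree : ℕ) : ℂ) * log (m : ℂ) + log (a j) + log (ratio j m)‖ :=
            norm_add_le _ _
        _ ≤ ‖(2 * Real.pi * I * (p j : ℂ) : ℂ)‖ +
            (‖(((Ah j).totalDegree : ℕ) : ℂ) * log (m : ℂ)‖ + ‖log (a j)‖ + ‖log (ratio j m)‖) := by
            have h3 := norm_add₃_le (a := (((Ah j).totalDegree : ℕ) : ℂ) * log (m : ℂ))
              (b := log (a j)) (c := log (ratio j m))
            linarith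
        _ ≤ Dg * Real.log m + (K - 1) := by
            rw [hn1]
            nlinarith [hm j, hdj, hKj, hlogm]
    have hD0 : 0 ≤ Dg := by rw [hDg]; exact Finset.sum_nonneg fun j _ => Nat.cast_nonneg _
    have hK2 : 2 ≤ K := by
      rw [hK]
      have := Finset.sum_nonneg fun j (_ : j ∈ (Finset.univ : Finset (Fin (s + 1)))) =>
        (show 0 ≤ ‖(2 * Real.pi * I * (p j : ℂ) : ℂ)‖ + ‖log (a j)‖ by positivity)
      linarith
    have hnn : 0 ≤ Dg * Real.log m + (K - 1) := by
      have := mul_nonneg hD0 hlogm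
      linarith
    have hnorm : ‖cen m - fun i => (m : ℂ) * (2 * Real.pi * I * (q i : ℂ))‖ ≤
        Dg * Real.log m + (K - 1) :=
      (pi_norm_le_iff_of_nonneg hnn).2 hcomp
    linarith
  -- (C3) the two-sided control of the real parts on the unit polydiscs
  set Cb : ℝ := ∑ j, ‖log (a j)‖ + 2 with hCb
  have hCb0 : 0 ≤ Cb := by rw [hCb]; positivity
  have hbox : ∀ᶠ m : ℕ in atTop, ∀ ξ : Fin (s + 1) → ℂ, ‖ξ‖ ≤ 1 →
      ∀ j, |(cen m j + ξ j).re - (fastData r c A F j).totalDegree * Real.log m| ≤ Cb := by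
    filter_upwards [eventually_all.2 hlog1] with m hm ξ hξ j
    rw [hc', hlb]
    dsimp only
    have hre : ((m : ℂ) * (2 * Real.pi * I * (q j : ℂ)) + (2 * Real.pi * I * (p j : ℂ) +
        ((((Ah j).totalDegree : ℕ) : ℂ) * log (m : ℂ) + log (a j) + log (ratio j m))) + ξ j).re =
        (Ah j).totalDegree * Real.log m + ((log (a j)).re + (log (ratio j m)).re + (ξ j).re) := by
      rw [← Complex.natCast_log]
      simp only [Complex.add_re, Complex.mul_re, Complex.mul_im, Complex.natCast_re,
        Complex.natCast_im, Complex.ofReal_re, Complex.ofReal_im, Complex.I_re, Complex.I_im,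
        Complex.re_ofNat, Complex.im_ofNat, Complex.intCast_re, Complex.intCast_im, mul_zero,
        zero_mul, add_zero, zero_add, sub_zero, mul_one, sub_self]
      ring
    rw [hre, show (fastData r c A F j).totalDegree = (Ah j).totalDegree from rfl, add_sub_cancel_left]
    have h1 := Complex.abs_re_le_norm (log (a j))
    have h2 := (Complex.abs_re_le_norm (log (ratio j m))).trans (hm j)
    have h3 := (Complex.abs_re_le_norm (ξ j)).trans ((norm_le_pi_norm ξ j).trans hξ)
    have h4 := abs_add_three ((log (a j)).re) ((log (ratio j m)).re) ((ξ j).re)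
    have h5 : ‖log (a j)‖ ≤ ∑ i, ‖log (a i)‖ :=
      Finset.single_le_sum (f := fun i => ‖log (a i)‖) (fun _ _ => norm_nonneg _) (Finset.mem_univ j)
    rw [hCb]
    linarith
  -- the perturbation
  obtain ⟨P, hP⟩ : ∃ P : Fin (s + 1) → (Fin (s + 1) → ℂ) → ℂ, P =
    Fin.cons (fun z : Fin (s + 1) → ℂ => ((F 0).leadingCoeff)⁻¹ *
        (exp (fastBack r c ((F 0).natDegree + 1) z 0) -
          exp (z 0 / (((F 0).natDegree + 1 : ℕ) : ℂ)) *
            (F 0).eraseLead.eval (exp (z 0 / (((F 0).natDegree + 1 : ℕ) : ℂ)))))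
      (fun (i : Fin s) (z : Fin (s + 1) → ℂ) => exp (z 0 / (((F 0).natDegree + 1 : ℕ) : ℂ)) *
        (F i.succ).eval (exp (z 0 / (((F 0).natDegree + 1 : ℕ) : ℂ)))) := ⟨_, rfl⟩
  have hP0 : ∀ z : Fin (s + 1) → ℂ, P 0 z = c₀⁻¹ * (exp (fastBack r c e z 0) -
      exp (z 0 / (e : ℂ)) * Fe.eval (exp (z 0 / (e : ℂ)))) := fun z => by
    simp only [hP, Fin.cons_zero, he, hc₀def, hFe]
  have hPs : ∀ (i : Fin s) (z : Fin (s + 1) → ℂ),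
      P i.succ z = exp (z 0 / (e : ℂ)) * (F i.succ).eval (exp (z 0 / (e : ℂ))) :=
    fun i z => by simp only [hP, Fin.cons_succ, he]
  have h0diff : Differentiable ℂ (fun z : Fin (s + 1) → ℂ => z 0) := differentiable_apply 0
  have hudiff : Differentiable ℂ (fun z : Fin (s + 1) → ℂ => exp (z 0 / (e : ℂ))) := by
    simp_rw [div_eq_mul_inv]; exact (h0diff.mul_const _).cexp
  have hbackdiff : Differentiable ℂ (fun z : Fin (s + 1) → ℂ => fastBack r c e z 0) := by
    simp only [fastBack_zero]
    simp_rw [div_eq_mul_inv]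
    refine ((((h0diff.mul_const _).sub ?_).sub_const _).mul_const _)
    exact Differentiable.fun_sum fun i _ => (differentiable_apply _).const_mul _
  have hPdiff' : ∀ j, Differentiable ℂ (P j) := by
    intro j
    refine Fin.cases ?_ (fun i => ?_) j
    · have : P 0 = fun z => c₀⁻¹ * (exp (fastBack r c e z 0) -
          exp (z 0 / (e : ℂ)) * Fe.eval (exp (z 0 / (e : ℂ)))) := funext (hP0 ·)
      rw [this]
      exact (hbackdiff.cexp.sub (hudiff.mul (Fe.differentiable.comp hudiff))).const_mul _
    · have : P i.succ = fun z => exp (z 0 / (e : ℂ)) * (F i.succ).eval (exp (z 0 / (e : ℂ))) :=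
        funext (hPs i ·)
      rw [this]
      exact hudiff.mul ((F i.succ).differentiable.comp hudiff)
  have hPdiff : ∀ᶠ m : ℕ in atTop, ∀ j, DifferentiableOn ℂ ((fun _ : ℕ => P) m j) (ball (cen m) 1) :=
    Eventually.of_forall fun m j => (hPdiff' j).differentiableOn
  have hPsmall : ∀ j, ∀ θ : ℝ, 0 < θ → ∀ᶠ m : ℕ in atTop, ∀ ξ : Fin (s + 1) → ℂ, ‖ξ‖ < 1 →
      ‖(fun _ : ℕ => P) m j (cen m + ξ)‖ ≤ θ * (m : ℝ) ^ (Ah j).totalDegree := by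
    intro j θ hθ
    have h := mixed_perturbation_small r hr c A F hF hd0 hν hfast cen Cb hCb0 hbox j θ hθ
    rw [← hP] at h
    exact h
  -- (C5) solutions near the centres, and a sequence with `z(m) - cen(m) → 0`
  have hsol : ∀ ε : ℝ, 0 < ε → ∀ᶠ m : ℕ in atTop, ∃ z ∈ {z : Fin (s + 1) → ℂ |
      ∀ j, exp (z j) = eval z (Ah j) + P j z}, ‖z - cen m‖ ≤ ε := by
    intro ε hε
    filter_upwards [exists_exp_eq_poly_add_near_centre q Ah hA cen hcexp hcsmall (fun _ => P) hPdiff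
      hPsmall hε] with m hm
    obtain ⟨z, hz, hsol⟩ := hm
    exact ⟨z, hsol, hz⟩
  obtain ⟨z, hzS, hzc⟩ := exists_seq_of_forall_eventually_exists_near _ cen hsol
  refine ⟨z, fun m => z m - (((Real.log m : ℝ) : ℂ) • (fun j => (((Ah j).totalDegree : ℕ) : ℂ)) +
    (2 * Real.pi * I * (m : ℂ)) • (fun j => (q j : ℂ))), ?_, fun m => ?_, ?_⟩
  · -- translation back to the original system
    filter_upwards [hzS] with m hsys j
    have hell : ell r c (fastBack r c e (z m)) = z m 0 / (e : ℂ) := ell_fastBack hr c e (z m)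
    rw [hell]
    refine Fin.cases ?_ (fun i => ?_) j
    · -- the fast coordinate
      have h := hsys 0
      rw [hP0, show Ah 0 = fastData r c A F 0 from rfl, eval_fastData_zero, ← hc₀def, ← he] at h
      refine exp_eq_of_fast_identity (F 0) ?_
      rw [← he, ← hc₀def, ← hFe, h]
      field_simp
    · -- the slow coordinates
      have h := hsys i.succ
      rw [hPs, show Ah i.succ = fastData r c A F i.succ from rfl, eval_fastData_succ] at h
      rw [fastBack_succ]
      exact h
  · rw [add_assoc, sub_add_cancel]
  · -- `ρ(m) = (z(m) - cen(m)) + rp(m) → 0 + r_p`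
    have heq : (fun m : ℕ => z m - (((Real.log m : ℝ) : ℂ) • (fun j => (((Ah j).totalDegree : ℕ) : ℂ)) +
        (2 * Real.pi * I * (m : ℂ)) • (fun j => (q j : ℂ)))) = fun m => (z m - cen m) + rp m := by
      funext m
      rw [hcen, hrc, hd, hy, Complex.natCast_log]
      dsimp only
      abel
    rw [heq]
    simp only [ha] at hrp_lim
    have h := hzc.add hrp_lim
    rw [zero_add] at h
    exact h

end MixedLabelled

end Summit.Schanuel.Schanuel.Theorems

end
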